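import Literature.NumberTheory.Rogawski1990.KottwitzSign
import Literature.NumberTheory.Rogawski1990.AdelicStableOrbitalIntegral
import Literature.NumberTheory.Rogawski1990.ArchimedeanTransfer
import HarnessLib

/-!
# Kottwitz signs, II: the local ∕ archimedean ∕ adelic class functions `e_v`, `e_∞`, `e_𝐀` of `U(H)` over a CM field and the SIGNED
# stable orbital sums (Rogawski 1990, §4.1 (4.1.2) pp. 39–40; §8.2 p. 117; §5.4 (5.4.3) pp. 72–73)

Topic `NumberTheory/Rogawski1990`; namespace `Literature.NumberTheory.Rogawski1990`.  DEFINITIONS WITH BODIES + book-keeping theorems;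
**no named fact, no `sorry`, no instance, no notation**.  Cell `pub/hodgecm-mathlib`, ENGINE T1 (crux H413 = `stmt-HodgeConjecture-24833`),
row O7 «singular semisimple classes», LETTERS LEAF «KOTTWITZ SIGNS» (F0P3a-plan RULING #116 (W19-1)), sequel of ★ `KottwitzSign` (the
ring-generic matrix sign `kottwitzSign σ H X`).  HC_CM is proved only modulo the printed citations until rung 0 closes; this file discharges
none of them.

## What is defined (letters) and proved (book-keeping)

* §2 on the carriers of ★ `UnitaryGroup.cmDatum L N H`: **`kottwitzSignLocal L N H v`** on `ConjClasses ((cmDatum L N H).Local v)` (the matrix sign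
  over `L ⊗ L⁺_v` for `c ⊗ 1` and `H ⊗ 1`, `kottwitzSignLocal_mk`); **`kottwitzSignAt L N H w`** (the sign of the `w`-coordinate, ★ `evalC`, of an
  element of `U(H)(L⁺ ⊗ ℝ)`, a class function `kottwitzSignAt_conj`) and **`kottwitzSignArch L N H`** on `ConjClasses (arch …)` = the PRODUCT
  over the complex places `w` of `L` (one above each real place of `L⁺`) of the `e_w` — `e(G_∞) = ∏_w e(G_w)`, NOT one isotropy test over
  `L ⊗ ℝ` (`kottwitzSignArch_mk`); **`kottwitzSignAdelic L N H g := e_∞(g_∞) · ∏ᶠ_v e_v(g_v)`** (★ `archPart`, ★ `toLocal`; `kottwitzSignAdelic_conj`),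
  its class version `kottwitzSignAdelicClass` (`…_mk`) and the complex weights `kottwitzSignWeight` (`…_mk`, `…_mul_self`) ∕ `kottwitzSignArchWeight`.
* §3 SIGNED SUMS = the tree's WEIGHTED sums with the sign as the weight PARAMETER — NO new adelic sum: the signed adelic stable sum over a class
  set `𝒞` (★ `MatchingAdeleG₂.classes`, ★ `MatchingAdeleG.classes`, …) is ★ `adelicKappaOrbitalSum 𝒞 (kottwitzSignWeight L N H) m f` itself
  (O7 OWNER WORD #24 (R-c)); for the archimedean carrier, where the tree has only the unweighted ★ `archStableOrbitalIntegral`, the summation set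
  `archStableClasses γ`, the complex weight `kottwitzSignArchWeight`, and the WEIGHT-PARAMETRIC **`archKappaOrbitalIntegral L N H w m a γ =
  Σ_{[γ′] ⊂ 𝒪_st(γ)} w([γ′]) Φ([γ′], a)`** (at `w := kottwitzSignArchWeight` = print's SIGNED `Φ^st(γ, f_∞)` of (4.1.2): at the split singular class
  of `U(2,1)(ℝ)` `Φ(γ₀,f) − Φ(γ₀′,f)`, STABLE [Prop. 8.2.1 (d)], while the unsigned sum there is print's unstable `Φ^κ`); `archKappaOrbitalIntegral_one`
  (`w ≡ 1` ⇒ ★ `archStableOrbitalIntegral`), `…_eq_of_forall_eq_one`, `…_kottwitzSignArchWeight_eq_of_forall_eq_one`, and the generic weight algebra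
  `adelicKappaOrbitalSum_eq_of_forall_eq_one` ∕ `…_mul_eq_of_forall_eq_one` ∕ `…_eq_of_forall_eq` — so NOTHING stated at regular classes moves,
  and «signed stable = unsigned `κ`» ∕ «signed `κ` = unsigned stable» are one-line rewrites once `e_𝐀 = (−1)^{obs}` is supplied on the adelic
  stable class of a rational split-singular element (sequel).

NOT here (sequel `KottwitzSignReadings`): finite non-split `v`: `e_v = −1` ↔ anisotropic eigenplane; split `v`: `e_v = 1`; real `w`: `e_w = −1` ↔
definite eigenplane; `e_v(x) = e_v((γ₀)_v)·(−1)^{obs_v(x)}`; the product formula `kottwitzSignAdelic (toAdelic δ) = 1` (Hilbert reciprocity).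

## References
* [Rogawski1990] J. D. Rogawski, *Automorphic Representations of Unitary Groups in Three Variables*, Ann. of Math. Stud. 123 (1990), §4.1
  (4.1.1)–(4.1.2) pp. 39–40; §8.2 p. 117, Prop. 8.2.1 (d); §5.4 (5.4.3) pp. 72–73; §14.2 p. 232.
* [Kottwitz1983] R. E. Kottwitz, *Sign changes in harmonic analysis on reductive groups*, Trans. AMS 278 (1983), 289–297.
-/

set_option autoImplicit false

noncomputable section

open MeasureTheory NumberField NumberField.InfinitePlace IsDedekindDomain Matrix
open scoped MatrixGroups

namespace Literature.NumberTheory.Rogawski1990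

open Literature.NumberTheory.Automorphic

/-! ## §2 The CM carriers: local, archimedean and adelic signs as class functions -/

section CM

variable (L : Type) [Field L] [NumberField L] [IsCMField L] (N : ℕ) (H : Matrix (Fin N) (Fin N) L)

/-- **`e_v` on the local classes** of `U(H)(L⁺_v) ≤ GL_N(L ⊗ L⁺_v)`: the matrix sign for the involution `c ⊗ 1` (★ `conjLocal`) and the local
Gram matrix `H ⊗ 1` (★ `adelicForm … |>.map adeleToLocal`), read at the chosen representative — independent of it by
`kottwitzSign_units_conj` (`kottwitzSignLocal_mk`). [cite: Rogawski1990, §4.1 (4.1.2) p. 39] -/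
def kottwitzSignLocal (v : HeightOneSpectrum (𝓞 ↥(maximalRealSubfield L))) (c : ConjClasses ((UnitaryGroup.cmDatum L N H).Local v)) : ℤˣ :=
  kottwitzSign (UnitaryGroup.conjLocal L (IsCMField.complexConj L) v)
    ((UnitaryGroup.adelicForm L N H).map (UnitaryGroup.adeleToLocal L v))
    (((Quotient.out c).val : GL (Fin N) (UnitaryGroup.LocalRing L v)).val : Matrix (Fin N) (Fin N) (UnitaryGroup.LocalRing L v))

/-- `e_v([x]) = e(x)`: the local class sign is the matrix sign of ANY representative. [cite: Rogawski1990, §4.1 (4.1.2) p. 39] -/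
theorem kottwitzSignLocal_mk (v : HeightOneSpectrum (𝓞 ↥(maximalRealSubfield L))) (x : (UnitaryGroup.cmDatum L N H).Local v) :
    kottwitzSignLocal L N H v (ConjClasses.mk x) =
      kottwitzSign (UnitaryGroup.conjLocal L (IsCMField.complexConj L) v)
        ((UnitaryGroup.adelicForm L N H).map (UnitaryGroup.adeleToLocal L v))
        ((x.val : GL (Fin N) (UnitaryGroup.LocalRing L v)).val : Matrix (Fin N) (Fin N) (UnitaryGroup.LocalRing L v)) := by
  obtain ⟨g, hg⟩ := isConj_iff.1 (ConjClasses.mk_eq_mk_iff_isConj.1 (Quotient.out_eq (ConjClasses.mk x)))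
  -- `g * out [x] * g⁻¹ = x`
  unfold kottwitzSignLocal
  have hmat : ((x.val : GL (Fin N) (UnitaryGroup.LocalRing L v)).val : Matrix (Fin N) (Fin N) (UnitaryGroup.LocalRing L v)) =
      ((g.val : GL (Fin N) (UnitaryGroup.LocalRing L v)).val : Matrix (Fin N) (Fin N) (UnitaryGroup.LocalRing L v)) *
        (((Quotient.out (ConjClasses.mk x)).val : GL (Fin N) (UnitaryGroup.LocalRing L v)).val : Matrix (Fin N) (Fin N) (UnitaryGroup.LocalRing L v)) *
        (((g.val : GL (Fin N) (UnitaryGroup.LocalRing L v))⁻¹).val : Matrix (Fin N) (Fin N) (UnitaryGroup.LocalRing L v)) := by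
    have h1 := congrArg (fun y : (UnitaryGroup.cmDatum L N H).Local v =>
      ((y.val : GL (Fin N) (UnitaryGroup.LocalRing L v)).val : Matrix (Fin N) (Fin N) (UnitaryGroup.LocalRing L v))) hg
    rw [← h1]; rfl
  rw [hmat]
  exact (kottwitzSign_units_conj (σ := UnitaryGroup.conjLocal L (IsCMField.complexConj L) v)
    (H := (UnitaryGroup.adelicForm L N H).map (UnitaryGroup.adeleToLocal L v)) g.2 _).symm

/-- The `w`-coordinate sign of an archimedean element: `e_w(x) := e((x)_w)` for conjugation and `w(H)`. [cite: Rogawski1990, §8.2 p. 117] -/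
def kottwitzSignAt (w : {w : InfinitePlace L // IsComplex w})
    (x : ↥(UnitaryGroup.arch (↥(maximalRealSubfield L)) L (IsCMField.complexConj L) N H)) : ℤˣ :=
  kottwitzSign (starRingEnd ℂ) ((UnitaryGroup.archFormOf L N H).map (UnitaryGroup.evalC L w))
    (((x : GL (Fin N) (mixedEmbedding.mixedSpace L)) : Matrix (Fin N) (Fin N) (mixedEmbedding.mixedSpace L)).map (UnitaryGroup.evalC L w))

open scoped Classical in
/-- **`e_∞` on the archimedean classes** of `U(H)(L⁺ ⊗ ℝ) ≤ GL_N(L ⊗ ℝ)`: the PRODUCT over the complex places `w` of `L` (one above each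
real place of `L⁺`) of the coordinate signs `e_w` of the chosen representative (independent of it, `kottwitzSignArch_mk`) —
`e(G_∞) = ∏_{w} e(G_w)`; NOT one isotropy test over `L ⊗ ℝ` (a vector supported at a single coordinate would see only one place).
[cite: Rogawski1990, §4.1 (4.1.2) p. 39; §8.2 p. 117] -/
def kottwitzSignArch (c : ConjClasses ↥(UnitaryGroup.arch (↥(maximalRealSubfield L)) L (IsCMField.complexConj L) N H)) : ℤˣ :=
  ∏ w : {w : InfinitePlace L // IsComplex w}, kottwitzSignAt L N H w (Quotient.out c)

variable {L N H} in
/-- `e_w` is a class function on `U(H)(L⁺ ⊗ ℝ)` (the `w`-coordinate of a unitary element is unitary for `w(H)` when `c ⊗ 1` is conjugation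
on the coordinate, ★ `evalC_conjMixed`). [cite: Rogawski1990, §4.1 (4.1.2) p. 39] -/
theorem kottwitzSignAt_conj (w : {w : InfinitePlace L // IsComplex w})
    (g x : ↥(UnitaryGroup.arch (↥(maximalRealSubfield L)) L (IsCMField.complexConj L) N H)) :
    kottwitzSignAt L N H w (g * x * g⁻¹) = kottwitzSignAt L N H w x := by
  unfold kottwitzSignAt
  set τ := UnitaryGroup.evalC L w with hτ
  set Hw : Matrix (Fin N) (Fin N) ℂ := (UnitaryGroup.archFormOf L N H).map τ
  -- the `w`-coordinate of `g` as a unit, and its unitarity for `Hw`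
  set gw : GL (Fin N) ℂ := Matrix.GeneralLinearGroup.map (τ : mixedEmbedding.mixedSpace L →+* ℂ) (g : GL (Fin N) (mixedEmbedding.mixedSpace L))
    with hgw
  have hgwval : (gw : Matrix (Fin N) (Fin N) ℂ) = (((g : GL (Fin N) (mixedEmbedding.mixedSpace L)) : Matrix (Fin N) (Fin N) _)).map τ := rfl
  have hgwinv : ((gw⁻¹ : GL (Fin N) ℂ) : Matrix (Fin N) (Fin N) ℂ) =
      ((((g⁻¹ : ↥(UnitaryGroup.arch (↥(maximalRealSubfield L)) L (IsCMField.complexConj L) N H)) : GL (Fin N) (mixedEmbedding.mixedSpace L)) :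
        Matrix (Fin N) (Fin N) _)).map τ := by
    rw [hgw, ← map_inv]; rfl
  have hunit : ((gw : Matrix (Fin N) (Fin N) ℂ).map (starRingEnd ℂ))ᵀ * Hw * (gw : Matrix (Fin N) (Fin N) ℂ) = Hw := by
    have hmem := (UnitaryGroup.mem_arch_iff (↥(maximalRealSubfield L)) L (IsCMField.complexConj L) N H _).1 g.2
    have key := congrArg (fun A : Matrix (Fin N) (Fin N) (mixedEmbedding.mixedSpace L) => A.map τ) hmem
    simp only [Matrix.map_mul, Matrix.transpose_map] at key
    have hστ : ((((g : GL (Fin N) (mixedEmbedding.mixedSpace L)) : Matrix (Fin N) (Fin N) _).map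
        (UnitaryGroup.conjMixed (↥(maximalRealSubfield L)) L (IsCMField.complexConj L))).map τ) =
        ((((g : GL (Fin N) (mixedEmbedding.mixedSpace L)) : Matrix (Fin N) (Fin N) _).map τ).map (starRingEnd ℂ)) := by
      rw [Matrix.map_map, Matrix.map_map]
      congr 1
      funext y
      exact UnitaryGroup.evalC_conjMixed (↥(maximalRealSubfield L)) L (IsCMField.complexConj L)
        (UnitaryGroup.complexConj_smul_infinitePlace L w.1) (IsCMField.complexConj_ne_one L) y
    rw [hστ] at key
    exact key
  have hprod : ((((g * x * g⁻¹ : ↥(UnitaryGroup.arch (↥(maximalRealSubfield L)) L (IsCMField.complexConj L) N H)) :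
        GL (Fin N) (mixedEmbedding.mixedSpace L)) : Matrix (Fin N) (Fin N) _).map τ) =
      (gw : Matrix (Fin N) (Fin N) ℂ) * ((((x : GL (Fin N) (mixedEmbedding.mixedSpace L)) : Matrix (Fin N) (Fin N) _)).map τ) *
        ((gw⁻¹ : GL (Fin N) ℂ) : Matrix (Fin N) (Fin N) ℂ) := by
    rw [hgwinv, hgwval, ← Matrix.map_mul, ← Matrix.map_mul]
    rfl
  rw [hprod]
  exact kottwitzSign_units_conj (σ := starRingEnd ℂ) (H := Hw) hunit _

variable {L N H} in
open scoped Classical in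
/-- `e_∞([x]) = ∏_w e_w(x)`: the archimedean class sign is the product of the coordinate signs of ANY representative.
[cite: Rogawski1990, §4.1 (4.1.2) p. 39] -/
theorem kottwitzSignArch_mk (x : ↥(UnitaryGroup.arch (↥(maximalRealSubfield L)) L (IsCMField.complexConj L) N H)) :
    kottwitzSignArch L N H (ConjClasses.mk x) = ∏ w : {w : InfinitePlace L // IsComplex w}, kottwitzSignAt L N H w x := by
  classical
  obtain ⟨g, hg⟩ := isConj_iff.1 (ConjClasses.mk_eq_mk_iff_isConj.1 (Quotient.out_eq (ConjClasses.mk x)))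
  unfold kottwitzSignArch
  refine Finset.prod_congr rfl fun w _ => ?_
  calc kottwitzSignAt L N H w (Quotient.out (ConjClasses.mk x))
      = kottwitzSignAt L N H w (g * Quotient.out (ConjClasses.mk x) * g⁻¹) := (kottwitzSignAt_conj w g _).symm
    _ = kottwitzSignAt L N H w x := by rw [hg]

/-- **`e_𝐀(g) := e_∞(g_∞) · ∏ᶠ_v e_v(g_v)`** for `g ∈ U(H)(𝔸_{L⁺})` (★ `archPart`, ★ `toLocal`): the adelic Kottwitz sign — the weight by which
the SIGNED adelic stable sum differs from the unsigned one class by class.  (`∏ᶠ` = `1` on an infinite support; finiteness of the support on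
the adelic stable class of a rational element is a theorem of the sequel.) [cite: Rogawski1990, §4.1 (4.1.2) p. 39; §5.4 p. 72] -/
def kottwitzSignAdelic (g : (UnitaryGroup.cmDatum L N H).Adelic) : ℤˣ :=
  kottwitzSignArch L N H (ConjClasses.mk (UnitaryGroup.archPart (↥(maximalRealSubfield L)) L (IsCMField.complexConj L) N H g)) *
    ∏ᶠ v : HeightOneSpectrum (𝓞 ↥(maximalRealSubfield L)), kottwitzSignLocal L N H v (ConjClasses.mk ((UnitaryGroup.cmDatum L N H).toLocal v g))

variable {L N H} in
/-- `e_𝐀` is a class function on `U(H)(𝔸)`. [cite: Rogawski1990, §4.1 (4.1.2) p. 39] -/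
theorem kottwitzSignAdelic_conj (g x : (UnitaryGroup.cmDatum L N H).Adelic) :
    kottwitzSignAdelic L N H (g * x * g⁻¹) = kottwitzSignAdelic L N H x := by
  unfold kottwitzSignAdelic
  have hprod : UnitaryGroup.archPart (↥(maximalRealSubfield L)) L (IsCMField.complexConj L) N H (g * x * g⁻¹) =
      UnitaryGroup.archPart (↥(maximalRealSubfield L)) L (IsCMField.complexConj L) N H g *
        UnitaryGroup.archPart (↥(maximalRealSubfield L)) L (IsCMField.complexConj L) N H x *
        (UnitaryGroup.archPart (↥(maximalRealSubfield L)) L (IsCMField.complexConj L) N H g)⁻¹ := by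
    rw [← map_inv, ← map_mul, ← map_mul]
    rfl
  have harch : ConjClasses.mk (UnitaryGroup.archPart (↥(maximalRealSubfield L)) L (IsCMField.complexConj L) N H (g * x * g⁻¹)) =
      ConjClasses.mk (UnitaryGroup.archPart (↥(maximalRealSubfield L)) L (IsCMField.complexConj L) N H x) := by
    rw [hprod]
    exact ConjClasses.mk_eq_mk_iff_isConj.2 (isConj_iff.2 ⟨_, rfl⟩).symm
  have hloc : ∀ v, ConjClasses.mk ((UnitaryGroup.cmDatum L N H).toLocal v (g * x * g⁻¹)) =
      ConjClasses.mk ((UnitaryGroup.cmDatum L N H).toLocal v x) := fun v => by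
    rw [map_mul, map_mul, map_inv]
    exact ConjClasses.mk_eq_mk_iff_isConj.2 (isConj_iff.2 ⟨_, rfl⟩).symm
  rw [harch]
  simp_rw [hloc]

/-- **`e_𝐀` on the adelic classes** (read at the chosen representative; `kottwitzSignAdelicClass_mk`). [cite: Rogawski1990, §5.4 p. 72] -/
def kottwitzSignAdelicClass (c : ConjClasses (UnitaryGroup.cmDatum L N H).Adelic) : ℤˣ :=
  kottwitzSignAdelic L N H (Quotient.out c)

variable {L N H} in
/-- `e_𝐀([g]) = e_𝐀(g)`. [cite: Rogawski1990, §5.4 p. 72] -/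
theorem kottwitzSignAdelicClass_mk (g : (UnitaryGroup.cmDatum L N H).Adelic) :
    kottwitzSignAdelicClass L N H (ConjClasses.mk g) = kottwitzSignAdelic L N H g := by
  obtain ⟨h, hh⟩ := isConj_iff.1 (ConjClasses.mk_eq_mk_iff_isConj.1 (Quotient.out_eq (ConjClasses.mk g)))
  unfold kottwitzSignAdelicClass
  rw [← kottwitzSignAdelic_conj h (Quotient.out (ConjClasses.mk g)), hh]

/-- The adelic class sign as a COMPLEX WEIGHT `ConjClasses → ℂ` — the `w` of ★ `adelicKappaOrbitalSum` ∕ ★ `adelicKappaOrbitalIntegralG′` ∕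
★ `adelicKappaOrbitalIntegralG` that turns them into the SIGNED stable sums `Σ_δ e(δ) Φ(δ, f)`. [cite: Rogawski1990, §4.1 (4.1.2) p. 39] -/
def kottwitzSignWeight (c : ConjClasses (UnitaryGroup.cmDatum L N H).Adelic) : ℂ :=
  ((kottwitzSignAdelicClass L N H c : ℤˣ) : ℤ)

variable {L N H} in
/-- `w_e([g]) = e_𝐀(g)` as a complex number. [cite: Rogawski1990, §4.1 (4.1.2) p. 39] -/
theorem kottwitzSignWeight_mk (g : (UnitaryGroup.cmDatum L N H).Adelic) :
    kottwitzSignWeight L N H (ConjClasses.mk g) = (((kottwitzSignAdelic L N H g : ℤˣ) : ℤ) : ℂ) := by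
  rw [kottwitzSignWeight, kottwitzSignAdelicClass_mk]

variable {L N H} in
/-- `w_e(c)² = 1` (the weight is `±1`). [cite: Rogawski1990, §4.1 (4.1.2) p. 39] -/
theorem kottwitzSignWeight_mul_self (c : ConjClasses (UnitaryGroup.cmDatum L N H).Adelic) :
    kottwitzSignWeight L N H c * kottwitzSignWeight L N H c = 1 := by
  unfold kottwitzSignWeight
  rcases Int.units_eq_one_or (kottwitzSignAdelicClass L N H c) with h | h <;> simp [h]

/-- The archimedean class sign as a COMPLEX WEIGHT `ConjClasses U(H)(L⁺ ⊗ ℝ) → ℂ` — the `E_∞` by which the weight-parametric arch stable sum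
(`archKappaOrbitalIntegral`) becomes print's SIGNED `Φ^st(γ, f_∞)` of (4.1.2). [cite: Rogawski1990, §4.1 (4.1.2) p. 39; §8.2 p. 117] -/
def kottwitzSignArchWeight (c : ConjClasses ↥(UnitaryGroup.arch (↥(maximalRealSubfield L)) L (IsCMField.complexConj L) N H)) : ℂ :=
  ((kottwitzSignArch L N H c : ℤˣ) : ℤ)

variable {L N H} in
/-- `E_∞(c)² = 1`. [cite: Rogawski1990, §4.1 (4.1.2) p. 39] -/
theorem kottwitzSignArchWeight_mul_self (c : ConjClasses ↥(UnitaryGroup.arch (↥(maximalRealSubfield L)) L (IsCMField.complexConj L) N H)) :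
    kottwitzSignArchWeight L N H c * kottwitzSignArchWeight L N H c = 1 := by
  unfold kottwitzSignArchWeight
  rcases Int.units_eq_one_or (kottwitzSignArch L N H c) with h | h <;> simp [h]

/-! ## §3 The SIGNED stable orbital sums: the tree's weighted sums with the sign as weight -/



/-- **The archimedean stable class of `γ` as a set of `G_∞`-classes**: `{[γ′] : γ′ ∼_st γ}` for ★ `IsStablyConj (c ⊗ 1) (H ⊗ 1)`
(`GL_N(L ⊗ ℝ)`-conjugacy) — the summation set of ★ `archStableOrbitalIntegral`. [cite: Rogawski1990, §4.1 (4.1.1) p. 39; §14.2 p. 232] -/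
def archStableClasses (γ : ↥(UnitaryGroup.arch (↥(maximalRealSubfield L)) L (IsCMField.complexConj L) N H)) :
    Set (ConjClasses ↥(UnitaryGroup.arch (↥(maximalRealSubfield L)) L (IsCMField.complexConj L) N H)) :=
  {c | IsStablyConj (UnitaryGroup.conjMixed (↥(maximalRealSubfield L)) L (IsCMField.complexConj L)) (UnitaryGroup.archFormOf L N H) γ
    (Quotient.out c)}

variable {L N H} in
/-- Membership in `archStableClasses γ` (definitional). [cite: Rogawski1990, §4.1 (4.1.1) p. 39] -/
theorem mem_archStableClasses_iff (γ : ↥(UnitaryGroup.arch (↥(maximalRealSubfield L)) L (IsCMField.complexConj L) N H))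
    (c : ConjClasses ↥(UnitaryGroup.arch (↥(maximalRealSubfield L)) L (IsCMField.complexConj L) N H)) :
    c ∈ archStableClasses L N H γ ↔
      IsStablyConj (UnitaryGroup.conjMixed (↥(maximalRealSubfield L)) L (IsCMField.complexConj L)) (UnitaryGroup.archFormOf L N H) γ
        (Quotient.out c) :=
  Iff.rfl

variable [∀ γ : ↥(UnitaryGroup.arch (↥(maximalRealSubfield L)) L (IsCMField.complexConj L) N H),
  MeasurableSpace (↥(UnitaryGroup.arch (↥(maximalRealSubfield L)) L (IsCMField.complexConj L) N H) ⧸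
    Subgroup.centralizer ({γ} : Set ↥(UnitaryGroup.arch (↥(maximalRealSubfield L)) L (IsCMField.complexConj L) N H)))]

/-- **`Φ^w(γ, f_∞) = Σ_{[γ′] ⊂ 𝒪_st(γ)} w([γ′]) Φ([γ′], f_∞)` — the WEIGHT-PARAMETRIC archimedean stable orbital sum** on
`G_∞ = U(H)(L⁺ ⊗ ℝ)`: ★ `adelicKappaOrbitalSum` over `archStableClasses γ` (the summation set of ★ `archStableOrbitalIntegral`) with an arbitrary class
weight `w` (the tree lacks the arch weighted sum; the adelic one is ★ `adelicKappaOrbitalSum` itself — no new sum there).  At `w := kottwitzSignArchWeight`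
this is print's SIGNED `Φ^st(γ, f_∞)` of (4.1.2) (at the split singular class of `U(2,1)(ℝ)`: `Φ(γ₀, f) − Φ(γ₀′, f)`, STABLE [Prop. 8.2.1 (d)], while the
unsigned ★ `archStableOrbitalIntegral` there is print's unstable `Φ^κ`); at `w ≡ 1` it is ★ `archStableOrbitalIntegral` (`archKappaOrbitalIntegral_one`).
[cite: Rogawski1990, §4.1 (4.1.2) pp. 39–40; §8.2 p. 117; §14.2 p. 232] -/
def archKappaOrbitalIntegral (w : ConjClasses ↥(UnitaryGroup.arch (↥(maximalRealSubfield L)) L (IsCMField.complexConj L) N H) → ℂ)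
    (m : OrbitalMeasureFamily ↥(UnitaryGroup.arch (↥(maximalRealSubfield L)) L (IsCMField.complexConj L) N H))
    (a : ↥(UnitaryGroup.arch (↥(maximalRealSubfield L)) L (IsCMField.complexConj L) N H) → ℂ)
    (γ : ↥(UnitaryGroup.arch (↥(maximalRealSubfield L)) L (IsCMField.complexConj L) N H)) : ℂ :=
  adelicKappaOrbitalSum (Γ := ↥(UnitaryGroup.arch (↥(maximalRealSubfield L)) L (IsCMField.complexConj L) N H))
    (archStableClasses L N H γ) w m a

variable {L N H} in
/-- Unfolding: `Φ^w(γ, a) = Σᶠ_{c ∈ archStableClasses γ} w(c) · Φ(c, a)`. [cite: Rogawski1990, §4.1 (4.1.2) p. 39] -/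
theorem archKappaOrbitalIntegral_def (w : ConjClasses ↥(UnitaryGroup.arch (↥(maximalRealSubfield L)) L (IsCMField.complexConj L) N H) → ℂ)
    (m : OrbitalMeasureFamily ↥(UnitaryGroup.arch (↥(maximalRealSubfield L)) L (IsCMField.complexConj L) N H))
    (a : ↥(UnitaryGroup.arch (↥(maximalRealSubfield L)) L (IsCMField.complexConj L) N H) → ℂ)
    (γ : ↥(UnitaryGroup.arch (↥(maximalRealSubfield L)) L (IsCMField.complexConj L) N H)) :
    archKappaOrbitalIntegral L N H w m a γ = ∑ᶠ c ∈ archStableClasses L N H γ, w c * classOrbitalIntegral m a c :=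
  rfl

variable {L N H} in
/-- **`Φ^1 = Φ^st`**: the weight-one arch sum IS ★ `archStableOrbitalIntegral` (definitional bridge to ★ `stableOrbitalIntegralRel`).
[cite: Rogawski1990, §4.1 (4.1.1) p. 39] -/
theorem archKappaOrbitalIntegral_one
    (m : OrbitalMeasureFamily ↥(UnitaryGroup.arch (↥(maximalRealSubfield L)) L (IsCMField.complexConj L) N H))
    (a : ↥(UnitaryGroup.arch (↥(maximalRealSubfield L)) L (IsCMField.complexConj L) N H) → ℂ)
    (γ : ↥(UnitaryGroup.arch (↥(maximalRealSubfield L)) L (IsCMField.complexConj L) N H)) :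
    archKappaOrbitalIntegral L N H (fun _ => 1) m a γ = archStableOrbitalIntegral L N H m a γ := by
  rw [archKappaOrbitalIntegral, adelicKappaOrbitalSum_one]
  rfl

variable {L N H} in
/-- **Weighted = unweighted when the weight is `1` on the stable class of `γ`** — so at every REGULAR `γ` (signs trivial) the SIGNED integral
`archKappaOrbitalIntegral … kottwitzSignArchWeight …` IS ★ `archStableOrbitalIntegral` and nothing stated at regular classes moves.
[cite: Rogawski1990, §4.1 (4.1.2) p. 40] -/
theorem archKappaOrbitalIntegral_eq_of_forall_eq_one
    (w : ConjClasses ↥(UnitaryGroup.arch (↥(maximalRealSubfield L)) L (IsCMField.complexConj L) N H) → ℂ)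
    (m : OrbitalMeasureFamily ↥(UnitaryGroup.arch (↥(maximalRealSubfield L)) L (IsCMField.complexConj L) N H))
    (a : ↥(UnitaryGroup.arch (↥(maximalRealSubfield L)) L (IsCMField.complexConj L) N H) → ℂ)
    (γ : ↥(UnitaryGroup.arch (↥(maximalRealSubfield L)) L (IsCMField.complexConj L) N H))
    (h : ∀ c ∈ archStableClasses L N H γ, w c = 1) :
    archKappaOrbitalIntegral L N H w m a γ = archStableOrbitalIntegral L N H m a γ := by
  rw [← archKappaOrbitalIntegral_one, archKappaOrbitalIntegral_def, archKappaOrbitalIntegral_def]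
  exact finsum_congr fun c => finsum_congr fun hc => by rw [h c hc]

variable {L N H} in
/-- In particular for the SIGN weight: `kottwitzSignArch = 1` on the stable class of `γ` ⇒ signed = unsigned.
[cite: Rogawski1990, §4.1 (4.1.2) p. 40] -/
theorem archKappaOrbitalIntegral_kottwitzSignArchWeight_eq_of_forall_eq_one
    (m : OrbitalMeasureFamily ↥(UnitaryGroup.arch (↥(maximalRealSubfield L)) L (IsCMField.complexConj L) N H))
    (a : ↥(UnitaryGroup.arch (↥(maximalRealSubfield L)) L (IsCMField.complexConj L) N H) → ℂ)
    (γ : ↥(UnitaryGroup.arch (↥(maximalRealSubfield L)) L (IsCMField.complexConj L) N H))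
    (h : ∀ c ∈ archStableClasses L N H γ, kottwitzSignArch L N H c = 1) :
    archKappaOrbitalIntegral L N H (kottwitzSignArchWeight L N H) m a γ = archStableOrbitalIntegral L N H m a γ :=
  archKappaOrbitalIntegral_eq_of_forall_eq_one _ m a γ fun c hc => by rw [kottwitzSignArchWeight, h c hc, Units.val_one, Int.cast_one]

end CM

/-! ### Generic: a weighted sum with weights `1` on the summation set is the plain sum -/

section Weights

variable {Γ : Type*} [Group Γ] [∀ g : Γ, MeasurableSpace (Γ ⧸ Subgroup.centralizer ({g} : Set Γ))]

/-- **`Σ_{c ∈ 𝒞} w(c) Φ(c, f) = Σ_{c ∈ 𝒞} Φ(c, f)` when `w = 1` on `𝒞`** — the signed adelic stable sum (weight `e_𝐀`) IS the unsigned one on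
any class set where the sign is trivial (regular stable classes); likewise `e·κ`-sums reduce to `κ`-sums there.
[cite: Rogawski1990, §4.1 (4.1.2) p. 40; §5.4 (5.4.3) p. 73] -/
theorem adelicKappaOrbitalSum_eq_of_forall_eq_one (𝒞 : Set (ConjClasses Γ)) (w : ConjClasses Γ → ℂ) (m : OrbitalMeasureFamily Γ)
    (f : Γ → ℂ) (h : ∀ c ∈ 𝒞, w c = 1) : adelicKappaOrbitalSum 𝒞 w m f = adelicStableOrbitalSum 𝒞 m f := by
  rw [adelicKappaOrbitalSum_def, adelicStableOrbitalSum_def]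
  exact finsum_congr fun c => finsum_congr fun hc => by rw [h c hc, one_mul]

/-- **Twisting the weights by a sign that is `1` on `𝒞` changes nothing**: `Σ (e·w) Φ = Σ w Φ` when `e = 1` on `𝒞`.
[cite: Rogawski1990, §4.1 (4.1.2) p. 40] -/
theorem adelicKappaOrbitalSum_mul_eq_of_forall_eq_one (𝒞 : Set (ConjClasses Γ)) (e w : ConjClasses Γ → ℂ) (m : OrbitalMeasureFamily Γ)
    (f : Γ → ℂ) (h : ∀ c ∈ 𝒞, e c = 1) :
    adelicKappaOrbitalSum 𝒞 (fun c => e c * w c) m f = adelicKappaOrbitalSum 𝒞 w m f := by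
  rw [adelicKappaOrbitalSum_def, adelicKappaOrbitalSum_def]
  exact finsum_congr fun c => finsum_congr fun hc => by rw [h c hc, one_mul]

/-- **If `e · κ = 1` on `𝒞` then the `e·κ`-sum is the PLAIN sum and the `e`-sum is the `κ`-sum** (`e, κ` both `±1`-valued with `e = κ` on `𝒞`):
the shape in which «signed stable = unsigned κ» and «signed κ = unsigned stable» hold on the adelic stable class of a rational split-singular
element (sequel: `e_𝐀 = (−1)^{obs}` there). [cite: Rogawski1990, §4.1 (4.1.2) p. 39; §5.4 (5.4.3) p. 73] -/
theorem adelicKappaOrbitalSum_eq_of_forall_eq (𝒞 : Set (ConjClasses Γ)) (e w : ConjClasses Γ → ℂ) (m : OrbitalMeasureFamily Γ)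
    (f : Γ → ℂ) (h : ∀ c ∈ 𝒞, e c = w c) :
    adelicKappaOrbitalSum 𝒞 e m f = adelicKappaOrbitalSum 𝒞 w m f := by
  rw [adelicKappaOrbitalSum_def, adelicKappaOrbitalSum_def]
  exact finsum_congr fun c => finsum_congr fun hc => by rw [h c hc]

end Weights

end Literature.NumberTheory.Rogawski1990

end
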